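import Mathlib
import Literature.Computability.AlgebraicComplexity.NestFreeMatchingPoly
import Literature.Computability.AlgebraicComplexity.MonotoneCircuitNewtonPolytopeXC
import Literature.Algebra.Polynomial.NewtonPolytope
import Summits.ValiantsHypothesis.ValiantsHypothesis.Theses.FifoMatching
import HarnessLib

/-!
# XC-DIVISION, rung 1 — monotone division hardness for `NN_n` in EXTENSION-COMPLEXITY currency:
# «Minkowski sums `NFP_n + Newt(h)` stay xc-hard» ⇒ all multiples of `NN_n` are hard ⇒ `NNDivisionHard` (stmt-21181), BY NAME

Port to `Theorems/` (director-valiant g13 R212 (a); val-lit merged desk g12; porter val-port-4 g1) of the PROVED first lemma of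
val-idea-7 g7's idea `xc-division` (`Cruxes/NNLinearDegreeCofactorHard/Ideas/xc-division.md`; sketch `Sketch_xc_division.lean`
sha 3e92a562886b9baf, farm rc 0 / 0 sorry), in DEF-FREE by-name style: the sketch's line-local statements `XcMinkowskiHard`,
`NNMultiplesHard`, the threshold `T c n = 2^((log₂ n + c)^c)` and `newtR` are UNFOLDED over the library polynomial
`nestFreeMatchingPoly n ℝ≥0` (definitionally the route's inlined `NN_n`), and the route's residual item is concluded BY NAME.

The lever.  Over `ℝ≥0` there is no cancellation and `ℝ` is a domain, so `Newt(NN_n · h) = Newt(NN_n) + Newt(h)` EXACTLY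
(`newtonPolytope_mul` after `MvPolynomial.map NNReal.toRealHom`), while the tree's DEGREE-FREE theorem
`MonotoneCircuitEF.hasEFOfSize_newtonPolytope_complexity : HasEFOfSize (Newt f) (3 · L₊(f))` (Hrubeš–Yehudayoff 2021 Thm 35,
circuit form via hypergraph flows) turns every small monotone CIRCUIT for a multiple `NN_n · h` into a small extended
formulation of the Minkowski sum `NFP_n + Newt(h)`.

* `hasEFOfSize_minkowski_of_mul` / `hasEFOfSize_minkowski_of_multiple` — the xc-currency transfer itself, UNCONDITIONAL and
  pointwise: `NFP_n + Newt(h)` (real Newton polytopes) has an extended formulation of size `≤ 3 · L₊(NN_n · h)`.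
* ★ `multiplesHard_of_xcMinkowski` — **XC-MINKOWSKI ⇒ N3** (the sketch's theorem): if for every `c`, eventually in `n`, no
  Minkowski sum `NFP_n + Newt(h)` (`h ≠ 0` over `ℝ≥0`) has an EF of size `≤ 3 · 2^((log₂ n + c)^c)`, then every nonzero multiple
  `NN_n · h` has monotone circuit complexity `> 2^((log₂ n + c)^c)`, WHATEVER the degree of `h`.
* ★ `nnDivisionHard_of_xcMinkowski` — **XC-MINKOWSKI ⇒ stmt-21181 `Theses.FifoMatching.NNDivisionHard`**, BY NAME
  (the `+ L₊(h)` of the route decl is not charged).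

HONEST FRAMING: implications from an OPEN hypothesis.  XC-MINKOWSKI (equivalently, by the located-face chain K1 / item 27045,
the n-free COR-MINKOWSKI «`xc(COR(K_h) + Q) ≥ 2^{Ω(h)}` for every polytope `Q`») is a PROPOSED crux, NOT in print (idea card,
Barriers (1)–(4): xc is not monotone under Minkowski sums in general — matroid base polytopes vs the permutahedron — and FMPTW's
rectangle-covering bound does not transfer); it is NOT filed as an item and NOT claimed.  stmt-21181 `NNDivisionHard`, `NNNotVP`
and the summit remain OPEN; nothing here bears on `VP ≠ VNP`, which is NOT proved.

References: P. Hrubeš, A. Yehudayoff, *Shadows of Newton polytopes*, CCC 2021, Thm 35 [HrubesYehudayoff2021];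
G. Blekherman, P. Parrilo, R. Thomas (eds.), *Semidefinite Optimization and Convex Algebraic Geometry* (2012), Ch. 3 §3.3.4 (3.21)
[BlekhermanParriloThomas2012] (Newton polytope of a product).
-/

set_option autoImplicit false

-- the mandated summit-side namespace repeats a component by design (single-problem summit)
set_option linter.dupNamespace false

namespace Summit.ValiantsHypothesis.ValiantsHypothesis.Theorems.FifoMatching

namespace XcDivision

open scoped NNReal Pointwise
open MvPolynomial
open Literature.Computability.AlgebraicComplexity (complexity nestFreeMatchingPoly)
open Literature.Computability.AlgebraicComplexity.MonotoneCircuitEF (hasEFOfSize_newtonPolytope_complexity)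
open Literature.Algebra.Polynomial.NewtonPolytope (newtonPolytope newtonPolytope_mul)
open Literature.Barriers.PneNP (HasEFOfSize)

/-! ## The xc-currency transfer (unconditional) -/

/-- **Minkowski sums of Newton polytopes of the factors of a monotone product have small extended formulations**:
for `f, g` over `ℝ≥0`, the Minkowski sum `Newt(f) + Newt(g)` of the REAL Newton polytopes has an extended formulation of
size `≤ 3 · L₊(f · g)` — `Newt(f · g) = Newt(f) + Newt(g)` (`newtonPolytope_mul` over the domain `ℝ`, after the ring map
`ℝ≥0 → ℝ`) and the degree-free hypergraph-flow EF of a monotone circuit's Newton polytope.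
[cite: HrubesYehudayoff2021, Thm. 35; BlekhermanParriloThomas2012, Ch. 3 §3.3.4 (3.21)] -/
theorem hasEFOfSize_minkowski_of_mul {σ : Type} [Fintype σ] [DecidableEq σ] (f g : MvPolynomial σ ℝ≥0) :
    HasEFOfSize (newtonPolytope (MvPolynomial.map NNReal.toRealHom f) +
        newtonPolytope (MvPolynomial.map NNReal.toRealHom g)) (3 * complexity (f * g)) := by
  have hEF := hasEFOfSize_newtonPolytope_complexity (f * g)
  rwa [map_mul, newtonPolytope_mul] at hEF

/-- **The transfer for multiples of `NN_n`** (pointwise, unconditional): `NFP_n + Newt(h)` — with `NFP_n = Newt(NN_n)` the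
nest-free matching polytope as a real Newton polytope — has an extended formulation of size `≤ 3 · L₊(NN_n · h)`.
[cite: HrubesYehudayoff2021, Thm. 35] -/
theorem hasEFOfSize_minkowski_of_multiple (n : ℕ) (h : MvPolynomial (Fin (2 * n) × Fin (2 * n)) ℝ≥0) :
    HasEFOfSize (newtonPolytope (MvPolynomial.map NNReal.toRealHom (nestFreeMatchingPoly n ℝ≥0)) +
        newtonPolytope (MvPolynomial.map NNReal.toRealHom h))
      (3 * complexity (nestFreeMatchingPoly n ℝ≥0 * h)) :=
  hasEFOfSize_minkowski_of_mul (nestFreeMatchingPoly n ℝ≥0) h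

/-- Budget form of the transfer: a monotone circuit of size `≤ s` for `NN_n · h` yields an extended formulation of
`NFP_n + Newt(h)` of size `≤ 3 s`. [cite: HrubesYehudayoff2021, Thm. 35] -/
theorem hasEFOfSize_minkowski_of_complexity_le (n : ℕ) (h : MvPolynomial (Fin (2 * n) × Fin (2 * n)) ℝ≥0) {s : ℕ}
    (hs : complexity (nestFreeMatchingPoly n ℝ≥0 * h) ≤ s) :
    HasEFOfSize (newtonPolytope (MvPolynomial.map NNReal.toRealHom (nestFreeMatchingPoly n ℝ≥0)) +
        newtonPolytope (MvPolynomial.map NNReal.toRealHom h)) (3 * s) :=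
  (hasEFOfSize_minkowski_of_multiple n h).of_le (by omega)

/-! ## XC-MINKOWSKI ⇒ all multiples of `NN_n` are hard ⇒ `NNDivisionHard` -/

/-- ★ **FIRST LEMMA of line `xc-division` (val-idea-7 g7, PROVED): XC-Minkowski hardness ⇒ all nonzero multiples of `NN_n`
are hard for monotone CIRCUITS** — degree-free.  Hypothesis (the sketch's `XcMinkowskiHard`, unfolded): for every `c`,
eventually in `n`, NO Minkowski sum `NFP_n + Newt(h)` with `h ≠ 0` over `ℝ≥0` has an extended formulation of size
`≤ 3 · 2^((log₂ n + c)^c)`.  Conclusion (the sketch's / shadow line's `NNMultiplesHard` = N3, unfolded):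
`2^((log₂ n + c)^c) < L₊(NN_n · h)` for every nonzero `h`, eventually in `n`.  The hypothesis is an OPEN proposed crux.
[cite: HrubesYehudayoff2021, Thm. 35] -/
theorem multiplesHard_of_xcMinkowski
    (hX : ∀ c : ℕ, ∃ n₀ : ℕ, ∀ n ≥ n₀, ∀ h : MvPolynomial (Fin (2 * n) × Fin (2 * n)) ℝ≥0, h ≠ 0 →
      ¬ HasEFOfSize (newtonPolytope (MvPolynomial.map NNReal.toRealHom (nestFreeMatchingPoly n ℝ≥0)) +
          newtonPolytope (MvPolynomial.map NNReal.toRealHom h)) (3 * 2 ^ ((Nat.log 2 n + c) ^ c))) :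
    ∀ c : ℕ, ∃ n₀ : ℕ, ∀ n ≥ n₀, ∀ h : MvPolynomial (Fin (2 * n) × Fin (2 * n)) ℝ≥0, h ≠ 0 →
      2 ^ ((Nat.log 2 n + c) ^ c) < complexity (nestFreeMatchingPoly n ℝ≥0 * h) := by
  intro c
  obtain ⟨n₀, hn₀⟩ := hX c
  refine ⟨n₀, fun n hn h hh => ?_⟩
  by_contra hle
  push Not at hle
  exact hn₀ n hn h hh (hasEFOfSize_minkowski_of_complexity_le n h hle)

/-- ★ **XC-MINKOWSKI ⇒ the route's residual item stmt-ValiantsHypothesis-21181 `NNDivisionHard`, BY NAME**: the route decl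
inlines `NN_n` over `ℝ≥0` exactly as the library's `nestFreeMatchingPoly n ℝ≥0` (definitionally), and its `+ L₊(h)` is not
charged.  An implication from an OPEN hypothesis; 21181 stays OPEN. [cite: HrubesYehudayoff2021, Thm. 35] -/
theorem nnDivisionHard_of_xcMinkowski
    (hX : ∀ c : ℕ, ∃ n₀ : ℕ, ∀ n ≥ n₀, ∀ h : MvPolynomial (Fin (2 * n) × Fin (2 * n)) ℝ≥0, h ≠ 0 →
      ¬ HasEFOfSize (newtonPolytope (MvPolynomial.map NNReal.toRealHom (nestFreeMatchingPoly n ℝ≥0)) +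
          newtonPolytope (MvPolynomial.map NNReal.toRealHom h)) (3 * 2 ^ ((Nat.log 2 n + c) ^ c))) :
    Summit.ValiantsHypothesis.ValiantsHypothesis.Theses.FifoMatching.NNDivisionHard := by
  intro c
  obtain ⟨n₀, hn₀⟩ := multiplesHard_of_xcMinkowski hX c
  exact ⟨n₀, fun n hn h hh => lt_of_lt_of_le (hn₀ n hn h hh) (Nat.le_add_right _ _)⟩

end XcDivision

end Summit.ValiantsHypothesis.ValiantsHypothesis.Theorems.FifoMatching
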